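import Literature.MathematicalPhysics.QuantumLattice.HubbardTTPrimeThermalWindowCertificateSymm
import HarnessLib

/-!
# Joint (two-state) thermal certificates: the companion-side identity as an extra row of the one-state reader

Topic `MathematicalPhysics/QuantumLattice`. The thermal certificate reader
(`HubbardTTPrimeThermalWindowCertificateSymm.lean`, `IsTorusLimitOfMixture.re_expect_ge_of_thermal_certificate_symm_TT'_of_sectorGibbs`)
reads ONE state `ω`. The two-sector energy–entropy-balance rows of the canonical object
(`InfVolFermionStateTorusLimitTwoSectorEnergyEntropyBalance.lean` and its sequels: for a charged generator `B`,
`0 ≤ β Re ω(B̃ᴴ[H,B̃]) − s Re ω(B̃ᴴB̃) + q·r·Re ω′(B̃B̃ᴴ)` with the COMPANION torus limit `ω′` and the sector ratio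
`r ∈ [r_lo, r_hi]`) couple the moments of TWO states: a relaxation using them has two moment vectors and its dual
certificate is a PAIR of operator identities — one in `ω`'s algebra (objective side), one in `ω′`'s — sharing the
multipliers `λ_r ≥ 0` of the joint rows `0 ≤ Re ω(P_r) + Re ω′(Q_r)`.

This file proves the one lemma that reduces the pair to the one-state reader:

* `InfVolFermionState.re_expect_jointRows_nonneg_of_companion_certificate` — if the companion-side identity
  `−c₂·1 = Σ Λ₂,ab O_aᴴO_b + Σ_z N′_z + (Σ_r λ_r Q_r + Σ_e κ′_e G′_e) + (Σ_m d_m(V_mᴴ − V_m) + Σ_k a′_k W′_k)` holds in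
  `𝔄_{Λ''}` with `Λ₂ ⪰ 0`, `ω′(N′_z) = 0`, `κ′_e ≥ 0`, `0 ≤ Re ω′(G′_e)`, and the joint rows hold for `(ω, ω′)`, then
  `G₀ := Σ_r λ_r P_r + (Σ_k ‖a′_k‖ − c₂)·1 ∈ 𝔄_{Λ'}` satisfies `0 ≤ Re ω_{Λ'}(G₀)` — i.e. it is an admissible extra row
  `G_e` (with `κ = 1`) of the ONE-STATE reader applied to `ω`, whose own identity then carries `Σ_r λ_r P_r` on the
  objective side. Net effect of the pair: `c₁ + c₂ − Σ‖a_k‖ − Σ‖a′_k‖ + … ≤ Re ω_{Λ'}(Xw)`.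
* `jointRow_of_le_of_nonneg` — cell monotonicity: a parametrised row `0 ≤ p + q·r·b` with `q, b ≥ 0` and `r ≤ r_hi`
  gives the constant-coefficient joint row `0 ≤ p + q·r_hi·b` used inside a cell of an `r`-cover.

Everything is PROVED; no definition, no named fact. (Which joint rows are valid for which companion `ω′` is the
business of the two-sector files; here they are hypotheses.)

References: Fawzi–Fawzi–Scalet 2024 Thm. 3.6 (SDP relaxations of KMS states read through the dual) [FawziFawziScalet2024];
Kull et al. 2024 §5.3 (certificates with residuals) [KullEtAl2024]; Araki–Moriya 2003 §4.1 [ArakiMoriya2003].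
-/

noncomputable section

namespace Literature.MathematicalPhysics.QuantumLattice

open Matrix Finset HubbardWave0 Literature.Probability.LatticeModels
open Literature.MathematicalPhysics.QuantumManyBody.StateRelaxation
open scoped ComplexOrder BigOperators

/-- **Cell monotonicity of a parametrised joint row.** `0 ≤ p + q·r·b`, `0 ≤ q`, `0 ≤ b`, `r ≤ r_hi` ⇒
`0 ≤ p + q·r_hi·b` (the two-sector rows inside a cell `r ∈ [r_lo, r_hi]` of an `r`-cover; for the reversed rows use
`1/r ≤ 1/r_lo`). [cite: FawziFawziScalet2024, Thm. 3.6] -/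
theorem jointRow_of_le_of_nonneg {p q r rhi b : ℝ} (h : 0 ≤ p + q * r * b) (hq : 0 ≤ q) (hb : 0 ≤ b)
    (hr : r ≤ rhi) : 0 ≤ p + q * rhi * b := by
  have h1 : q * r * b ≤ q * rhi * b := by
    have := mul_le_mul_of_nonneg_left hr hq
    exact mul_le_mul_of_nonneg_right this hb
  linarith

namespace InfVolFermionState

variable {d : ℕ}

/-- **The companion-side identity of a joint certificate is an extra row for the one-state reader.** Let `ω, ω′`
be infinite-volume states (read on regions `Λ'`, `Λ''`), joint rows `0 ≤ Re ω_{Λ'}(P_r) + Re ω′_{Λ''}(Q_r)` with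
multipliers `λ_r ≥ 0` (`r ∈ rr`), and suppose the companion-side identity
`−c₂·1 = Σ Λ₂,ab O_aᴴ O_b + Σ_z N′_z + (Σ_r λ_r Q_r + Σ_e κ′_e G′_e) + (Σ_m d_m (V_mᴴ − V_m) + Σ_k a′_k W′_k)` in `𝔄_{Λ''}`
with `Λ₂ ⪰ 0`, `ω′(N′_z) = 0`, `κ′_e ≥ 0`, `0 ≤ Re ω′(G′_e)`, `W′_k` ladder words (norm `≤ 1`). Then
`0 ≤ Re ω_{Λ'}(Σ_r λ_r P_r + (Σ_k ‖a′_k‖ − c₂)·1)`: positivity of `ω′` on the Gram part, the null and nonnegative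
rows and the residual bound give `Σ_r λ_r Re ω′(Q_r) ≤ Σ‖a′_k‖ − c₂`, and the joint rows transfer it to `ω`.
[cite: FawziFawziScalet2024, Thm. 3.6] [cite: KullEtAl2024, §5.3] -/
theorem re_expect_jointRows_nonneg_of_companion_certificate (ω ω' : InfVolFermionState d)
    {Λ' Λ'' : Finset (Site d)}
    {θ : Type*} (rr : Finset θ) (lam : θ → ℝ) (hlam : ∀ r ∈ rr, 0 ≤ lam r)
    (P : θ → FermionOp Λ') (Q : θ → FermionOp Λ'')
    (hjoint : ∀ r ∈ rr, 0 ≤ (ω.expect Λ' (P r)).re + (ω'.expect Λ'' (Q r)).re)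
    {m : Type*} [Fintype m] [DecidableEq m] {Λm : Matrix m m ℂ} (hΛm : Λm.PosSemidef)
    (O : m → FermionOp Λ'')
    {ζ : Type*} (zz : Finset ζ) (Nz : ζ → FermionOp Λ'') (hnull : ∀ z ∈ zz, ω'.expect Λ'' (Nz z) = 0)
    {η : Type*} (gg : Finset η) (kap : η → ℝ) (hkap : ∀ e ∈ gg, 0 ≤ kap e) (G : η → FermionOp Λ'')
    (hG : ∀ e ∈ gg, 0 ≤ (ω'.expect Λ'' (G e)).re)
    {δ : Type*} (ah : Finset δ) (dc : δ → ℝ) (V : δ → FermionOp Λ'')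
    {κ'' : Type*} (w : Finset κ'') (a : κ'' → ℂ) (word : κ'' → List (Orb (PolySite Λ'') × Bool)) {c₂ : ℝ}
    (hcert₂ : -((c₂ : ℂ) • (1 : FermionOp Λ'')) =
      gramForm Λm O + ∑ z ∈ zz, Nz z +
        (∑ r ∈ rr, ((lam r : ℝ) : ℂ) • Q r + ∑ e ∈ gg, ((kap e : ℝ) : ℂ) • G e) +
        (∑ m' ∈ ah, ((dc m' : ℝ) : ℂ) • ((V m')ᴴ - V m') + ∑ k ∈ w, a k • ladderWord (word k))) :
    0 ≤ (ω.expect Λ' (∑ r ∈ rr, ((lam r : ℝ) : ℂ) • P r +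
      (((∑ k ∈ w, ‖a k‖) - c₂ : ℝ) : ℂ) • (1 : FermionOp Λ'))).re := by
  -- the companion functional is positive and normalised
  have hpos : ∀ A' : FermionOp Λ'', 0 ≤ ω'.expect Λ'' (star A' * A') := fun A' => by
    rw [Matrix.star_eq_conjTranspose]
    exact ω'.expect_nonneg Λ'' A'
  obtain ⟨hgram, -⟩ := Complex.nonneg_iff.mp (map_gramForm_nonneg (ω'.expect Λ'') hpos hΛm O)
  -- the null rows
  have hn : (ω'.expect Λ'' (∑ z ∈ zz, Nz z)).re = 0 := by
    rw [map_sum, Finset.sum_eq_zero hnull, Complex.zero_re]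
  -- the nonnegative rows of the companion
  have hg : 0 ≤ (ω'.expect Λ'' (∑ e ∈ gg, ((kap e : ℝ) : ℂ) • G e)).re := by
    rw [map_sum, Complex.re_sum]
    refine Finset.sum_nonneg fun e he => ?_
    rw [map_smul, smul_eq_mul, Complex.re_ofReal_mul]
    exact mul_nonneg (hkap e he) (hG e he)
  -- the residual
  have hah : (ω'.expect Λ'' (∑ m' ∈ ah, ((dc m' : ℝ) : ℂ) • ((V m')ᴴ - V m'))).re = 0 := by
    rw [map_sum, Complex.re_sum]
    refine Finset.sum_eq_zero fun m' _ => ?_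
    rw [map_smul, smul_eq_mul]
    exact ω'.re_ofReal_mul_expect_conjTranspose_sub_self Λ'' (dc m') (V m')
  have hres : -(∑ k ∈ w, ‖a k‖) ≤ (ω'.expect Λ'' (∑ k ∈ w, a k • ladderWord (word k))).re :=
    neg_sum_norm_le_re_map_sum w (ω'.expect Λ'') a (fun k => ladderWord (word k))
      fun k _ => ω'.neg_norm_le_re_mul_expect_ladderWord Λ'' (a k) (word k)
  -- apply `ω′` to the companion identity
  have hQ : (ω'.expect Λ'' (∑ r ∈ rr, ((lam r : ℝ) : ℂ) • Q r)).re = ∑ r ∈ rr, lam r * (ω'.expect Λ'' (Q r)).re := by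
    rw [map_sum, Complex.re_sum]
    refine Finset.sum_congr rfl fun r _ => ?_
    rw [map_smul, smul_eq_mul, Complex.re_ofReal_mul]
  have hid := congrArg (fun X => (ω'.expect Λ'' X).re) hcert₂
  simp only [map_neg, map_smul, map_add, ω'.expect_one, Complex.neg_re, Complex.add_re, smul_eq_mul, mul_one,
    Complex.ofReal_re] at hid
  rw [hQ] at hid
  -- `Σ λ_r Re ω′(Q_r) ≤ Σ‖a_k‖ − c₂`
  have hbound : ∑ r ∈ rr, lam r * (ω'.expect Λ'' (Q r)).re ≤ (∑ k ∈ w, ‖a k‖) - c₂ := by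
    have hn' : (ω'.expect Λ'' (∑ z ∈ zz, Nz z)).re = 0 := hn
    linarith
  -- transfer to `ω` through the joint rows
  have hP : (ω.expect Λ' (∑ r ∈ rr, ((lam r : ℝ) : ℂ) • P r +
      (((∑ k ∈ w, ‖a k‖) - c₂ : ℝ) : ℂ) • (1 : FermionOp Λ'))).re =
      ∑ r ∈ rr, lam r * (ω.expect Λ' (P r)).re + ((∑ k ∈ w, ‖a k‖) - c₂) := by
    rw [map_add, map_sum, map_smul, ω.expect_one, Complex.add_re, Complex.re_sum, smul_eq_mul, mul_one,
      Complex.ofReal_re]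
    congr 1
    refine Finset.sum_congr rfl fun r _ => ?_
    rw [map_smul, smul_eq_mul, Complex.re_ofReal_mul]
  rw [hP]
  have hsum : 0 ≤ ∑ r ∈ rr, lam r * ((ω.expect Λ' (P r)).re + (ω'.expect Λ'' (Q r)).re) :=
    Finset.sum_nonneg fun r hr => mul_nonneg (hlam r hr) (hjoint r hr)
  have hsplit : ∑ r ∈ rr, lam r * ((ω.expect Λ' (P r)).re + (ω'.expect Λ'' (Q r)).re) =
      ∑ r ∈ rr, lam r * (ω.expect Λ' (P r)).re + ∑ r ∈ rr, lam r * (ω'.expect Λ'' (Q r)).re := by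
    rw [← Finset.sum_add_distrib]
    refine Finset.sum_congr rfl fun r _ => ?_
    ring
  linarith

end InfVolFermionState

end Literature.MathematicalPhysics.QuantumLattice

end
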